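import Summits.Ventures.PercRepro.S2ThirteenEightNuSix

/-!
# PercRepro — S2: THE CIRCUIT CAPS AT CORANK `9` — THE CELLS `(13, 9)`, `(12, 9)` AND `(11, 9)` (p7, gen 19; sub-claim S2; the row `p = 13`)

The caps the cells of corank `9` feed to the kit: on the coloop-free `e`-free core of rank `13` on `22` points `s₃ ≤ 16`
(`TriangleCap.cq3 9`), `s₄ ≤ 121 = ⌊22·99/18⌋` (the averaging recursion on `avgChain16 8 = 99`), `s₅ ≤ 842 = ⌊22·651/17⌋` (on
`avgChain5b 8 = 651`) — **`caps_thirteen_nine_cf`**; on the scaled coloop-free cell `(12, 9)` (`21` points) `16 / 122 / 854` —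
**`caps_twelve_nine_cf`**; on the twice-scaled cell `(11, 9)` (`20` points, coloops allowed) the plain nullity-`9` caps
`16 / 138 / 1012` (`avgChain16 9`, `avgChain5b 9`) — **`caps_eleven_nine`**. Nothing about any cell is claimed. Axioms: standard.
-/

open scoped Matroid

namespace PercRepro

namespace ThmN

open Set

variable {α : Type}

/-- The coloop-free caps at `(13, 9)`: `s₃ ≤ 16`, `s₄ ≤ 121` (`⌊22·99/18⌋` on `avgChain16 8`), `s₅ ≤ 842` (`⌊22·651/17⌋`). -/
theorem caps_thirteen_nine_cf (M : Matroid α) [M.Finite]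
    (hd : M.E.encard = M.eRank + ((9 : ℕ) : ℕ∞)) (hn : M.E.ncard = 13 + 9)
    (hfree : ∀ e ∈ M.E, ∃ A ⊆ M.E \ {e}, e ∉ M.closure A ∧ e ∉ M.closure ((M.E \ {e}) \ A)) (hK : ∀ e, ¬ M.IsColoop e) :
    {C : Set α | M.IsCircuit C ∧ C.ncard = 3}.ncard ≤ 16 ∧
      {C : Set α | M.IsCircuit C ∧ C.ncard = 4}.ncard ≤ 121 ∧
        {C : Set α | M.IsCircuit C ∧ C.ncard = 5}.ncard ≤ 842 := by
  have hs3 := TriangleCap.core_ncard_triangles_le_cq3 M hfree hd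
  rw [show TriangleCap.cq3 9 = 16 by decide] at hs3
  have hcol : M.coloops = ∅ := S2.coloops_eq_empty_of_forall_not M hK
  have hm : 22 ≤ (M.E \ M.coloops).ncard := by
    rw [hcol, Set.sdiff_empty, hn]
  have hd' : M.E.encard = M.eRank + (((8 : ℕ) : ℕ∞) + 1) := by
    rw [hd]; norm_num
  have h := S1.ncard_fourCircuits_sub_div_le_of_nonColoops M hfree hd' (by norm_num) hm (B := 99)
    (fun M' _ hfree' hd'' => by
      have h := ncard_fourCircuits_le_avgChain16 8 M' hfree' hd''
      rw [show avgChain16 8 = 99 by decide] at h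
      exact h)
  have hs4 : {C : Set α | M.IsCircuit C ∧ C.ncard = 4}.ncard ≤ 121 := by
    have := S1.le_mul_div_of_sub_div_le (by norm_num : 4 < 22) h
    omega
  have hs5 := S2.ncard_fiveCircuits_le_of_no_coloop M hfree hd' hK (by omega)
  rw [hn] at hs5
  have h5 : (13 + 9) * S1.avgChain5b 8 / (13 + 9 - 5) = 842 := by
    rw [show S1.avgChain5b 8 = 651 by decide]
  rw [h5] at hs5
  exact ⟨hs3, hs4, hs5⟩

/-- The coloop-free caps at `(12, 9)`: `s₃ ≤ 16`, `s₄ ≤ 122` (`⌊21·99/17⌋`), `s₅ ≤ 854` (`⌊21·651/16⌋`). -/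
theorem caps_twelve_nine_cf (M : Matroid α) [M.Finite]
    (hd : M.E.encard = M.eRank + ((9 : ℕ) : ℕ∞)) (hn : M.E.ncard = 12 + 9)
    (hfree : ∀ e ∈ M.E, ∃ A ⊆ M.E \ {e}, e ∉ M.closure A ∧ e ∉ M.closure ((M.E \ {e}) \ A)) (hK : ∀ e, ¬ M.IsColoop e) :
    {C : Set α | M.IsCircuit C ∧ C.ncard = 3}.ncard ≤ 16 ∧
      {C : Set α | M.IsCircuit C ∧ C.ncard = 4}.ncard ≤ 122 ∧
        {C : Set α | M.IsCircuit C ∧ C.ncard = 5}.ncard ≤ 854 := by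
  have hs3 := TriangleCap.core_ncard_triangles_le_cq3 M hfree hd
  rw [show TriangleCap.cq3 9 = 16 by decide] at hs3
  have hcol : M.coloops = ∅ := S2.coloops_eq_empty_of_forall_not M hK
  have hm : 21 ≤ (M.E \ M.coloops).ncard := by
    rw [hcol, Set.sdiff_empty, hn]
  have hd' : M.E.encard = M.eRank + (((8 : ℕ) : ℕ∞) + 1) := by
    rw [hd]; norm_num
  have h := S1.ncard_fourCircuits_sub_div_le_of_nonColoops M hfree hd' (by norm_num) hm (B := 99)
    (fun M' _ hfree' hd'' => by
      have h := ncard_fourCircuits_le_avgChain16 8 M' hfree' hd''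
      rw [show avgChain16 8 = 99 by decide] at h
      exact h)
  have hs4 : {C : Set α | M.IsCircuit C ∧ C.ncard = 4}.ncard ≤ 122 := by
    have := S1.le_mul_div_of_sub_div_le (by norm_num : 4 < 21) h
    omega
  have hs5 := S2.ncard_fiveCircuits_le_of_no_coloop M hfree hd' hK (by omega)
  rw [hn] at hs5
  have h5 : (12 + 9) * S1.avgChain5b 8 / (12 + 9 - 5) = 854 := by
    rw [show S1.avgChain5b 8 = 651 by decide]
  rw [h5] at hs5
  exact ⟨hs3, hs4, hs5⟩

/-- The caps at `(11, 9)` (coloops allowed): `s₃ ≤ 16`, `s₄ ≤ 138 = avgChain16 9`, `s₅ ≤ 1012 = avgChain5b 9`. -/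
theorem caps_eleven_nine (M : Matroid α) [M.Finite]
    (hd : M.E.encard = M.eRank + ((9 : ℕ) : ℕ∞))
    (hfree : ∀ e ∈ M.E, ∃ A ⊆ M.E \ {e}, e ∉ M.closure A ∧ e ∉ M.closure ((M.E \ {e}) \ A)) :
    {C : Set α | M.IsCircuit C ∧ C.ncard = 3}.ncard ≤ 16 ∧
      {C : Set α | M.IsCircuit C ∧ C.ncard = 4}.ncard ≤ 138 ∧
        {C : Set α | M.IsCircuit C ∧ C.ncard = 5}.ncard ≤ 1012 := by
  have hs3 := TriangleCap.core_ncard_triangles_le_cq3 M hfree hd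
  rw [show TriangleCap.cq3 9 = 16 by decide] at hs3
  have hs4 := ncard_fourCircuits_le_avgChain16 9 M hfree hd
  rw [show avgChain16 9 = 138 by decide] at hs4
  have hs5 := S1.ncard_fiveCircuits_le_avgChain5b 9 M hfree hd
  rw [show S1.avgChain5b 9 = 1012 by decide] at hs5
  exact ⟨hs3, hs4, hs5⟩

end ThmN

end PercRepro
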